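import Summits.QuantumFields.YangMills.Theorems.AllWindowsColdBoxBoxHighLineGhostLogDetHS
import Literature.LinearAlgebra.Matrix.TraceAevalRoots

/-!
# T-S5.7d⁽⁴⁾ input (sub-brick (a) of «GhostTaylorEven»): the HILBERT–SCHMIDT form of the THIRD-order expansion of `log |det (1 + X)|`

Free-hands helper of LEAD ym-line-sfw-p2 g78 for planner ym-idea-2 g18's ★FLAG-2 (2026-08-30T01:19:49Z) «7d⁽⁴⁾ GhostTaylorEven»
(`|(ghostLogRatio a + ghostLogRatio(−a))/2 − quadVal (ghostM H) a| ≤ C·H⁸·(1+log H)^m·t⁴`, K3′ row RA-ghost of U5 = `stub_landauThirdOrder`,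
⟨stmt-QuantumFields-24336⟩).  The even symmetrisation kills the cubic order, so the log-det expansion is needed one order further than w3 g40's
✓`LogDetHS.logDet_hs` (second order, remainder `(2ρ/3)‖X‖²_HS`):

  `|log |det (1 + X)| − tr X + tr (X²)/2 − tr (X³)/3| ≤ (ρ²/2) · Σ_{i,j} X_{ij}²`   (`0 ≤ ρ ≤ 1/2`, `‖Xv‖² ≤ ρ²‖v‖²` for all `v`)

for a real square matrix over ANY finite index type (`logDet_hs4`).  Same spectral route (`det(1+X) = Π(1+λᵢ)`, `tr Xᵏ = Σλᵢᵏ` — the cube by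
✓`Literature.LinearAlgebra.Matrix.matrix_trace_aeval_eq_sum_roots_charpoly` at `g = X³`, `|λᵢ| ≤ ρ`, Schur `Σ|λᵢ|² ≤ ‖X‖²_HS`) with the quartic Taylor
remainder `‖log(1+z) − z + z²/2 − z³/3‖ ≤ ‖z‖⁴/(4(1−‖z‖)) ≤ (ρ²/2)‖z‖²`.  For the Faddeev–Popov perturbation (`ρ ≍ H²t`, `‖X‖²_HS ≍ H⁴(log)⁴t²`) the
remainder is `≍ H⁸(log)⁴t⁴` — the `H⁸` of the flag.

* `logTaylor_four`, `norm_log_sub_le_cube` — the scalar remainder;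
* `trace_map_cube` — `tr Y³ = ↑(tr X³)` for the complexification; `trace_cube_eq_sum_roots_cube` — `tr Y³ = Σ λᵢ³`;
* ★ `logDet_hs4_fin`, ★★ `logDet_hs4` (any `Fintype` index, by `Matrix.reindex`).

Everything proved, Mathlib + tree only, standard axioms; no definitions.  HONEST LABEL: a matrix-analysis input of ONE sub-brick of a K3′ row of an UNSTAFFED
stub of a critic-PASSed DRAFT line; 7d⁽⁴⁾ itself ((b) third-order chart remainder, (c) third-order FP expansion, (d) parity assembly) remains OPEN; U5, ⟨24004⟩, ⟨24336⟩
remain OPEN; no crux, rung or summit is proved; **the Yang–Mills mass gap is NOT proved by this file; no summit is proved by a line.**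
-/

set_option autoImplicit false

noncomputable section

open Matrix Finset Polynomial

namespace Summit.QuantumFields.YangMills.Theorems.AllWindowsColdBoxBoxHighLine

namespace LogDetHS

open LogDet

variable {n : ℕ}

/-- `logTaylor 4 z = z − z²/2 + z³/3`. -/
theorem logTaylor_four (z : ℂ) : Complex.logTaylor 4 z = z - z ^ 2 / 2 + z ^ 3 / 3 := by
  simp [Complex.logTaylor, Finset.sum_range_succ]
  ring

/-- `‖log (1 + z) − z + z²/2 − z³/3‖ ≤ (ρ²/2) ‖z‖²` for `‖z‖ ≤ ρ ≤ 1/2` (the quartic Taylor remainder keeps two powers of `‖z‖`). -/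
theorem norm_log_sub_le_cube {z : ℂ} {ρ : ℝ} (hz : ‖z‖ ≤ ρ) (hρ : ρ ≤ 1 / 2) :
    ‖Complex.log (1 + z) - z + z ^ 2 / 2 - z ^ 3 / 3‖ ≤ ρ ^ 2 / 2 * ‖z‖ ^ 2 := by
  have hz1 : ‖z‖ < 1 := by linarith [norm_nonneg z]
  have h := Complex.norm_log_sub_logTaylor_le 3 hz1
  rw [logTaylor_four] at h
  have hrw : Complex.log (1 + z) - z + z ^ 2 / 2 - z ^ 3 / 3 = Complex.log (1 + z) - (z - z ^ 2 / 2 + z ^ 3 / 3) := by ring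
  rw [hrw]
  refine h.trans ?_
  have h0 : 0 ≤ ‖z‖ := norm_nonneg z
  have hinv : (1 - ‖z‖)⁻¹ ≤ 2 := by
    rw [inv_le_comm₀ (by linarith) (by norm_num)]; linarith
  have hρ0 : 0 ≤ ρ := h0.trans hz
  have hz2 : ‖z‖ ^ 2 ≤ ρ ^ 2 := pow_le_pow_left₀ h0 hz 2
  calc ‖z‖ ^ (3 + 1) * (1 - ‖z‖)⁻¹ / (3 + 1) = ‖z‖ ^ 2 * (‖z‖ ^ 2 * (1 - ‖z‖)⁻¹) / 4 := by ring
    _ ≤ ‖z‖ ^ 2 * (ρ ^ 2 * 2) / 4 := by gcongr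
    _ = ρ ^ 2 / 2 * ‖z‖ ^ 2 := by ring

/-- `tr Y³ = ↑(tr X³)` for the complexification `Y` of `X`. -/
theorem trace_map_cube (X : Matrix (Fin n) (Fin n) ℝ) :
    (X.map ((↑) : ℝ → ℂ) * X.map ((↑) : ℝ → ℂ) * X.map ((↑) : ℝ → ℂ)).trace = (((X * X * X).trace : ℝ) : ℂ) := by
  rw [← trace_map (X * X * X)]
  show (Complex.ofRealHom.mapMatrix X * Complex.ofRealHom.mapMatrix X * Complex.ofRealHom.mapMatrix X).trace =
    (Complex.ofRealHom.mapMatrix (X * X * X)).trace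
  rw [← map_mul, ← map_mul]

/-- `tr (Y³) = Σ λᵢ³` over the roots of the characteristic polynomial (✓`matrix_trace_aeval_eq_sum_roots_charpoly` at `g = X³`). -/
theorem trace_cube_eq_sum_roots_cube (Y : Matrix (Fin n) (Fin n) ℂ) :
    (Y * Y * Y).trace = (Y.charpoly.roots.map fun z => z ^ 3).sum := by
  have h := Literature.LinearAlgebra.Matrix.matrix_trace_aeval_eq_sum_roots_charpoly Y ((Polynomial.X : ℂ[X]) ^ 3)
  simp only [map_pow, aeval_X, eval_pow, eval_X] at h
  rw [← h, pow_succ, pow_two]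

/-- ★ **The third-order Hilbert–Schmidt form on `Fin n`**: `|log |det (1 + X)| − tr X + tr(X²)/2 − tr(X³)/3| ≤ (ρ²/2) Σ X_{ij}²`. -/
theorem logDet_hs4_fin (X : Matrix (Fin n) (Fin n) ℝ) {ρ : ℝ} (h0 : 0 ≤ ρ) (h12 : ρ ≤ 1 / 2)
    (hX : ∀ v : Fin n → ℝ, X.mulVec v ⬝ᵥ X.mulVec v ≤ ρ ^ 2 * (v ⬝ᵥ v)) :
    (1 + X).det ≠ 0 ∧
      |Real.log |(1 + X).det| - X.trace + (X * X).trace / 2 - (X * X * X).trace / 3| ≤ ρ ^ 2 / 2 * ∑ i, ∑ j, X i j ^ 2 := by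
  have hdet : (1 + X).det ≠ 0 := det_one_add_ne_zero X h0 (by linarith) hX
  refine ⟨hdet, ?_⟩
  set Y : Matrix (Fin n) (Fin n) ℂ := X.map ((↑) : ℝ → ℂ) with hY
  set μ : Multiset ℂ := Y.charpoly.roots with hμ
  have hbound : ∀ z ∈ μ, ‖z‖ ≤ ρ := fun z hz => norm_le_of_mem_roots_charpoly X h0 hX hz
  have hne : ∀ z ∈ μ, 1 + z ≠ 0 := by
    intro z hz h
    have : ‖z‖ = 1 := by rw [← norm_neg, show -z = 1 from by linear_combination -h, norm_one]
    linarith [hbound z hz]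
  -- the four spectral identities
  have hD : (((1 + X).det : ℝ) : ℂ) = (μ.map fun z => 1 + z).prod := by rw [← det_one_add_map, det_one_add_eq_prod_roots]
  have hT1 : ((X.trace : ℝ) : ℂ) = μ.sum := by rw [← trace_map, Matrix.trace_eq_sum_roots_charpoly]
  have hT2 : (((X * X).trace : ℝ) : ℂ) = (μ.map fun z => z ^ 2).sum := by rw [← trace_map_sq, trace_sq_eq_sum_roots_sq]
  have hT3 : (((X * X * X).trace : ℝ) : ℂ) = (μ.map fun z => z ^ 3).sum := by rw [← trace_map_cube, trace_cube_eq_sum_roots_cube]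
  -- Schur's inequality
  have hSchur : (μ.map fun z => ‖z‖ ^ 2).sum ≤ ∑ i, ∑ j, X i j ^ 2 := by
    rw [← sum_norm_sq_map_ofReal X]
    exact Literature.Analysis.InnerProduct.matrix_sum_norm_sq_roots_charpoly_le Y
  -- `log |det (1 + X)| = Σ Re log (1 + λᵢ)`
  have hlog : Real.log |(1 + X).det| = (μ.map fun z => (Complex.log (1 + z)).re).sum := by
    have h1 : |(1 + X).det| = ‖(((1 + X).det : ℝ) : ℂ)‖ := by rw [Complex.norm_real, Real.norm_eq_abs]
    rw [h1, hD]
    have h2 : ‖(μ.map fun z => 1 + z).prod‖ = ((μ.map fun z => 1 + z).map fun w => ‖w‖).prod := by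
      have := map_multiset_prod (normHom : ℂ →*₀ ℝ) (μ.map fun z => 1 + z)
      simpa using this
    rw [h2, log_multiset_prod, Multiset.map_map, Multiset.map_map]
    · refine congrArg Multiset.sum (Multiset.map_congr rfl fun z _ => ?_)
      simp [Complex.log_re]
    · intro x hx
      rw [Multiset.mem_map] at hx
      obtain ⟨w, hw, rfl⟩ := hx
      rw [Multiset.mem_map] at hw
      obtain ⟨z, hz, rfl⟩ := hw
      exact norm_ne_zero_iff.2 (hne z hz)
  set F : ℂ → ℂ := fun z => Complex.log (1 + z) - z + z ^ 2 / 2 - z ^ 3 / 3 with hF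
  have hkey : Real.log |(1 + X).det| - X.trace + (X * X).trace / 2 - (X * X * X).trace / 3 = ((μ.map F).sum).re := by
    have hsum : (μ.map F).sum =
        (μ.map fun z => Complex.log (1 + z)).sum - μ.sum + (μ.map fun z => z ^ 2).sum * 2⁻¹ - (μ.map fun z => z ^ 3).sum * 3⁻¹ := by
      simp only [hF, Multiset.sum_map_add, Multiset.sum_map_sub, Multiset.map_id', div_eq_mul_inv, Multiset.sum_map_mul_right]
    have hre : ((μ.map fun z => Complex.log (1 + z)).sum).re = (μ.map fun z => (Complex.log (1 + z)).re).sum := by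
      have := map_multiset_sum Complex.reLm (μ.map fun z => Complex.log (1 + z))
      rw [Complex.reLm_coe, Multiset.map_map] at this
      exact this
    have h2 : ((μ.map fun z => z ^ 2).sum * 2⁻¹).re = (X * X).trace / 2 := by
      rw [← hT2, show (((X * X).trace : ℝ) : ℂ) * 2⁻¹ = (((X * X).trace / 2 : ℝ) : ℂ) by push_cast; ring, Complex.ofReal_re]
    have h3 : ((μ.map fun z => z ^ 3).sum * 3⁻¹).re = (X * X * X).trace / 3 := by
      rw [← hT3, show (((X * X * X).trace : ℝ) : ℂ) * 3⁻¹ = (((X * X * X).trace / 3 : ℝ) : ℂ) by push_cast; ring, Complex.ofReal_re]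
    rw [hsum, Complex.sub_re, Complex.add_re, Complex.sub_re, h2, h3, hre, ← hlog, ← hT1, Complex.ofReal_re]
  rw [hkey]
  have hρ3 : 0 ≤ ρ ^ 2 / 2 := by positivity
  calc |((μ.map F).sum).re| ≤ ‖(μ.map F).sum‖ := Complex.abs_re_le_norm _
    _ ≤ ((μ.map F).map fun w => ‖w‖).sum := norm_multiset_sum_le _
    _ ≤ ((μ.map fun z => ‖z‖ ^ 2).map fun s => ρ ^ 2 / 2 * s).sum := by
        rw [Multiset.map_map, Multiset.map_map]
        refine Multiset.sum_map_le_sum_map _ _ fun z hz => ?_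
        exact norm_log_sub_le_cube (hbound z hz) h12
    _ = ρ ^ 2 / 2 * (μ.map fun z => ‖z‖ ^ 2).sum := by rw [Multiset.sum_map_mul_left, Multiset.map_id']
    _ ≤ ρ ^ 2 / 2 * ∑ i, ∑ j, X i j ^ 2 := mul_le_mul_of_nonneg_left hSchur hρ3

/-- ★★ **The third-order Hilbert–Schmidt form, any finite index type**: for a real square matrix `X` with `‖Xv‖² ≤ ρ²‖v‖²` (`0 ≤ ρ ≤ 1/2`),
`det (1 + X) ≠ 0` and `|log |det (1 + X)| − tr X + tr(X·X)/2 − tr(X·X·X)/3| ≤ (ρ²/2) · Σ_{i,j} X_{ij}²`. -/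
theorem logDet_hs4 {ι : Type*} [Fintype ι] [DecidableEq ι] (X : Matrix ι ι ℝ) {ρ : ℝ} (h0 : 0 ≤ ρ) (h12 : ρ ≤ 1 / 2)
    (hX : ∀ v : ι → ℝ, X.mulVec v ⬝ᵥ X.mulVec v ≤ ρ ^ 2 * (v ⬝ᵥ v)) :
    (1 + X).det ≠ 0 ∧
      |Real.log |(1 + X).det| - X.trace + (X * X).trace / 2 - (X * X * X).trace / 3| ≤ ρ ^ 2 / 2 * ∑ i, ∑ j, X i j ^ 2 := by
  classical
  set e := Fintype.equivFin ι with he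
  set X' : Matrix (Fin (Fintype.card ι)) (Fin (Fintype.card ι)) ℝ := Matrix.reindex e e X with hX'
  have hX'v : ∀ v : Fin (Fintype.card ι) → ℝ, X'.mulVec v ⬝ᵥ X'.mulVec v ≤ ρ ^ 2 * (v ⬝ᵥ v) := by
    intro v
    have hmv : X' *ᵥ v = (X *ᵥ (v ∘ e)) ∘ e.symm := by
      rw [hX', Matrix.reindex_apply, Matrix.submatrix_mulVec_equiv, Equiv.symm_symm]
    have h1 : X' *ᵥ v ⬝ᵥ X' *ᵥ v = (X *ᵥ (v ∘ e)) ⬝ᵥ (X *ᵥ (v ∘ e)) := by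
      rw [hmv]
      exact Equiv.sum_comp e.symm (fun i => (X *ᵥ (v ∘ e)) i * (X *ᵥ (v ∘ e)) i)
    have h2 : v ⬝ᵥ v = (v ∘ e) ⬝ᵥ (v ∘ e) := by
      symm
      exact Equiv.sum_comp e (fun i => v i * v i)
    rw [h1, h2]
    exact hX (v ∘ e)
  have hdet : (1 + X').det = (1 + X).det := by
    have h1 : 1 + X' = Matrix.reindex e e (1 + X) := by
      ext i j
      simp only [hX', Matrix.reindex_apply, Matrix.add_apply, Matrix.submatrix_apply, Matrix.one_apply,
        Equiv.apply_eq_iff_eq]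
    rw [h1, Matrix.det_reindex_self]
  have htr : X'.trace = X.trace := by
    rw [hX', Matrix.reindex_apply, Matrix.trace]
    simp only [Matrix.diag_apply, Matrix.submatrix_apply]
    exact Equiv.sum_comp e.symm (fun i => X i i)
  have hmul : X' * X' = Matrix.reindex e e (X * X) := by
    rw [hX', Matrix.reindex_apply, Matrix.reindex_apply, Matrix.submatrix_mul_equiv]
  have hmul3 : X' * X' * X' = Matrix.reindex e e (X * X * X) := by
    rw [hmul, hX', Matrix.reindex_apply, Matrix.reindex_apply, Matrix.reindex_apply, Matrix.submatrix_mul_equiv]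
  have htr2 : (X' * X').trace = (X * X).trace := by
    rw [hmul, Matrix.reindex_apply, Matrix.trace]
    simp only [Matrix.diag_apply, Matrix.submatrix_apply]
    exact Equiv.sum_comp e.symm (fun i => (X * X) i i)
  have htr3 : (X' * X' * X').trace = (X * X * X).trace := by
    rw [hmul3, Matrix.reindex_apply, Matrix.trace]
    simp only [Matrix.diag_apply, Matrix.submatrix_apply]
    exact Equiv.sum_comp e.symm (fun i => (X * X * X) i i)
  have hfro : ∑ i, ∑ j, X' i j ^ 2 = ∑ i, ∑ j, X i j ^ 2 := by
    rw [hX', Matrix.reindex_apply]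
    simp only [Matrix.submatrix_apply]
    rw [Equiv.sum_comp e.symm (fun i => ∑ j, X i (e.symm j) ^ 2)]
    exact Finset.sum_congr rfl fun i _ => Equiv.sum_comp e.symm (fun j => X i j ^ 2)
  have h := logDet_hs4_fin X' h0 h12 hX'v
  rw [hdet, htr, htr2, htr3, hfro] at h
  exact h

end LogDetHS

end Summit.QuantumFields.YangMills.Theorems.AllWindowsColdBoxBoxHighLine

end
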